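import Literature.NumberTheory.Automorphic.MixedSpaceMomentKernelsFourier
import Literature.NumberTheory.Automorphic.HilbertRepSpectrum
import HarnessLib

/-!
# The Kirillov representation of the archimedean mirabolic group `P₂(K_∞)` on `L²(K_∞ˣ)`

Topic `NumberTheory/Automorphic`; namespace `Literature.NumberTheory.Automorphic`. Definitions with
bodies and theorems (no named fact). For `K_∞ = K ⊗_ℚ ℝ = mixedSpace K`, a Haar measure `μ` on
`K_∞ˣ` and Tate's archimedean character `ψ_∞(ξ x) = archChar K ξ x = e^{i B(ξ, x)}`,
`B = archCharForm K = -2π Tr_{K_∞/ℝ}(ξ x)`: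

* `mirabolicTwo K ≤ GL₂(K_∞)` — the mirabolic subgroup `P₂ = {(a b; 0 1)}`; `mirabolicFst`
  (`p ↦ a ∈ K_∞ˣ`, a group homomorphism) and the entry `b = p₀₁`, with
  `(pq)₀₀ = p₀₀ q₀₀`, `(pq)₀₁ = p₀₀ q₀₁ + p₀₁`;
* `kirillovDilation μ y` (`f ↦ f(· y)`, `y ∈ K_∞ˣ`) and `kirillovMulChar μ x`
  (`f ↦ ψ_∞(· x) f`, `x ∈ K_∞`), linear isometries of `L²(K_∞ˣ, μ)`;
* `kirillovRep K μ : ContRepresentation ℂ (mirabolicTwo K) (Lp ℂ 2 μ)` — **the Kirillov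
  representation** `(ρ(p) f)(u) = ψ_∞(u p₀₁) f(u p₀₀)`, i.e. the induced representation
  `τ₂ = Ind_{N₂}^{P₂} θ` realised on `L²(N₂ \ P₂) = L²(K_∞ˣ)` (Jacquet–Shalika (1981), (3.5):
  "`τ_r = Ind(P_r, N_r; θ_r)`"; Kirillov (1962); Bump (1997), §2.8 for `GL₂(ℝ)`), with the pointwise
  formula `coeFn_kirillovRep` and **unitarity** `isUnitary_kirillovRep`.

It is the target of the Kirillov map `v ↦ (u ↦ ℓ(τ(diag(u,1)) v))`, which intertwines the
restriction to `P₂` of a representation `τ` of `GL₂(K_∞)` carrying a `ψ_∞`-Whittaker functional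
`ℓ` with `ρ` (`ℓ(τ(diag(u,1) p) v) = ψ_∞(u p₀₁) ℓ(τ(diag(u p₀₀, 1)) v)`), on the route to the named
fact `Literature.NumberTheory.Automorphic.JacquetShalika1981_archKirillovNorm_le`.

## References

* H. Jacquet, J. A. Shalika, *On Euler products and the classification of automorphic
  representations I*, Amer. J. Math. 103 (1981), §3, (3.5) [JacquetShalikaAJM1981].
* A. A. Kirillov, *Infinite-dimensional representations of the complete matrix group*, Dokl.
  Akad. Nauk SSSR 144 (1962), 37–39.
* D. Bump, *Automorphic Forms and Representations* (1997), §2.8 [Bump1997].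
-/

noncomputable section

open scoped Classical Real ENNReal MatrixGroups ComplexConjugate
open NumberField NumberField.mixedEmbedding NumberField.InfinitePlace MeasureTheory Complex

namespace Literature.NumberTheory.Automorphic

variable (K : Type) [Field K] [NumberField K]

/-! ### 1. The mirabolic subgroup `P₂(K_∞)` -/

/-- **The mirabolic subgroup** `P₂(K_∞) = {g ∈ GL₂(K_∞) | g₁₀ = 0, g₁₁ = 1}` (Jacquet–Shalika (1981),
§3: `P_r`). [cite: JacquetShalikaAJM1981, §3, (3.5)] -/
def mirabolicTwo : Subgroup (GL (Fin 2) (mixedSpace K)) where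
  carrier := {g | (g : Matrix (Fin 2) (Fin 2) (mixedSpace K)) 1 0 = 0 ∧ (g : Matrix (Fin 2) (Fin 2) (mixedSpace K)) 1 1 = 1}
  one_mem' := by
    refine ⟨?_, ?_⟩ <;> simp
  mul_mem' := by
    rintro g h ⟨hg0, hg1⟩ ⟨hh0, hh1⟩
    refine ⟨?_, ?_⟩
    · change ((g : Matrix (Fin 2) (Fin 2) (mixedSpace K)) * (h : Matrix (Fin 2) (Fin 2) (mixedSpace K))) 1 0 = 0
      rw [Matrix.mul_apply, Fin.sum_univ_two, hg0, hg1, hh0, zero_mul, one_mul, add_zero]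
    · change ((g : Matrix (Fin 2) (Fin 2) (mixedSpace K)) * (h : Matrix (Fin 2) (Fin 2) (mixedSpace K))) 1 1 = 1
      rw [Matrix.mul_apply, Fin.sum_univ_two, hg0, hg1, hh1, zero_mul, one_mul, zero_add]
  inv_mem' := by
    rintro g ⟨hg0, hg1⟩
    have h := Units.mul_inv g
    have h10 := congrArg (fun M : Matrix (Fin 2) (Fin 2) (mixedSpace K) => M 1 0) h
    have h11 := congrArg (fun M : Matrix (Fin 2) (Fin 2) (mixedSpace K) => M 1 1) h
    simp only [Matrix.mul_apply, Fin.sum_univ_two, hg0, hg1, zero_mul, one_mul, zero_add,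
      Matrix.one_apply_ne (by decide : (1 : Fin 2) ≠ 0), Matrix.one_apply_eq] at h10 h11
    exact ⟨h10, h11⟩

variable {K}

omit [NumberField K] in
/-- Membership in the mirabolic subgroup. [folklore] -/
theorem mem_mirabolicTwo_iff (g : GL (Fin 2) (mixedSpace K)) :
    g ∈ mirabolicTwo K ↔ (g : Matrix (Fin 2) (Fin 2) (mixedSpace K)) 1 0 = 0 ∧ (g : Matrix (Fin 2) (Fin 2) (mixedSpace K)) 1 1 = 1 :=
  Iff.rfl

omit [NumberField K] in
/-- `(g⁻¹)₀₀ g₀₀ = 1` for `g` in the mirabolic subgroup. [folklore] -/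
theorem mirabolicTwo_inv_mul_entry (p : mirabolicTwo K) :
    (((p : GL (Fin 2) (mixedSpace K))⁻¹ : GL (Fin 2) (mixedSpace K)) : Matrix (Fin 2) (Fin 2) (mixedSpace K)) 0 0 *
      ((p : GL (Fin 2) (mixedSpace K)) : Matrix (Fin 2) (Fin 2) (mixedSpace K)) 0 0 = 1 := by
  have h := Units.inv_mul (p : GL (Fin 2) (mixedSpace K))
  have h00 := congrArg (fun M : Matrix (Fin 2) (Fin 2) (mixedSpace K) => M 0 0) h
  simp only [Matrix.mul_apply, Fin.sum_univ_two, p.2.1, mul_zero, add_zero, Matrix.one_apply_eq] at h00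
  exact h00

omit [NumberField K] in
/-- `g₀₀ (g⁻¹)₀₀ = 1` for `g` in the mirabolic subgroup. [folklore] -/
theorem mirabolicTwo_mul_inv_entry (p : mirabolicTwo K) :
    ((p : GL (Fin 2) (mixedSpace K)) : Matrix (Fin 2) (Fin 2) (mixedSpace K)) 0 0 *
      (((p : GL (Fin 2) (mixedSpace K))⁻¹ : GL (Fin 2) (mixedSpace K)) : Matrix (Fin 2) (Fin 2) (mixedSpace K)) 0 0 = 1 := by
  rw [mul_comm]; exact mirabolicTwo_inv_mul_entry p

/-- **The diagonal entry `p ↦ p₀₀ ∈ K_∞ˣ` of the mirabolic subgroup**, a group homomorphism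
(`(pq)₀₀ = p₀₀ q₀₀` since `q₁₀ = 0`). [folklore] -/
def mirabolicFst : mirabolicTwo K →* (mixedSpace K)ˣ where
  toFun p := ⟨((p : GL (Fin 2) (mixedSpace K)) : Matrix (Fin 2) (Fin 2) (mixedSpace K)) 0 0,
    (((p : GL (Fin 2) (mixedSpace K))⁻¹ : GL (Fin 2) (mixedSpace K)) : Matrix (Fin 2) (Fin 2) (mixedSpace K)) 0 0,
    mirabolicTwo_mul_inv_entry p, mirabolicTwo_inv_mul_entry p⟩
  map_one' := Units.ext (by simp)
  map_mul' p q := Units.ext (by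
    change (((p : GL (Fin 2) (mixedSpace K)) * (q : GL (Fin 2) (mixedSpace K)) : GL (Fin 2) (mixedSpace K)) :
        Matrix (Fin 2) (Fin 2) (mixedSpace K)) 0 0 = _ * _
    rw [Units.val_mul, Matrix.mul_apply, Fin.sum_univ_two, q.2.1, mul_zero, add_zero])

omit [NumberField K] in
/-- `(mirabolicFst p : K_∞) = p₀₀`. [folklore] -/
@[simp] theorem coe_mirabolicFst (p : mirabolicTwo K) :
    ((mirabolicFst p : (mixedSpace K)ˣ) : mixedSpace K) = ((p : GL (Fin 2) (mixedSpace K)) : Matrix (Fin 2) (Fin 2) (mixedSpace K)) 0 0 :=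
  rfl

omit [NumberField K] in
/-- The entry `p₀₁` of a product in the mirabolic subgroup: `(pq)₀₁ = p₀₀ q₀₁ + p₀₁` (`q₁₁ = 1`). [folklore] -/
theorem mirabolicTwo_mul_entry01 (p q : mirabolicTwo K) :
    (((p * q : mirabolicTwo K) : GL (Fin 2) (mixedSpace K)) : Matrix (Fin 2) (Fin 2) (mixedSpace K)) 0 1 =
      ((p : GL (Fin 2) (mixedSpace K)) : Matrix (Fin 2) (Fin 2) (mixedSpace K)) 0 0 *
          ((q : GL (Fin 2) (mixedSpace K)) : Matrix (Fin 2) (Fin 2) (mixedSpace K)) 0 1 +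
        ((p : GL (Fin 2) (mixedSpace K)) : Matrix (Fin 2) (Fin 2) (mixedSpace K)) 0 1 := by
  change ((((p : GL (Fin 2) (mixedSpace K)) * (q : GL (Fin 2) (mixedSpace K)) : GL (Fin 2) (mixedSpace K)) :
      Matrix (Fin 2) (Fin 2) (mixedSpace K)) 0 1) = _
  rw [Units.val_mul, Matrix.mul_apply, Fin.sum_univ_two, q.2.2, mul_one]

/-! ### 2. Dilations and multiplications by characters on `L²(K_∞ˣ)` -/

section Operators

variable [MeasurableSpace ((mixedSpace K)ˣ)] [BorelSpace ((mixedSpace K)ˣ)]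
  (μ : Measure ((mixedSpace K)ˣ)) [μ.IsMulLeftInvariant]

/-- **Dilation** `f ↦ f(· y)` on `L²(K_∞ˣ, μ)`, a linear isometry (`μ` is translation invariant).
[folklore] -/
def kirillovDilation (y : (mixedSpace K)ˣ) : Lp ℂ 2 μ →ₗᵢ[ℂ] Lp ℂ 2 μ :=
  Lp.compMeasurePreservingₗᵢ ℂ (fun u : (mixedSpace K)ˣ => u * y) (measurePreserving_mul_right μ y)

omit [NumberField K] in
/-- `kirillovDilation μ y f = f(· y)` almost everywhere. [folklore] -/
theorem coeFn_kirillovDilation (y : (mixedSpace K)ˣ) (f : Lp ℂ 2 μ) :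
    kirillovDilation μ y f =ᵐ[μ] fun u => f (u * y) :=
  Lp.coeFn_compMeasurePreserving f (measurePreserving_mul_right μ y)

omit [MeasurableSpace ((mixedSpace K)ˣ)] [BorelSpace ((mixedSpace K)ˣ)] in
/-- The multiplier `u ↦ ψ_∞(u x)` is continuous. [folklore] -/
theorem continuous_archChar_coe (x : mixedSpace K) :
    Continuous fun u : (mixedSpace K)ˣ => archChar K (u : mixedSpace K) x := by
  unfold archChar
  refine Complex.continuous_exp.comp ((Complex.continuous_ofReal.comp ?_).mul continuous_const)
  exact (((archCharForm K).flip x).continuous_of_finiteDimensional).comp Units.continuous_val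

omit [μ.IsMulLeftInvariant] in
/-- The product `ψ_∞(· x) f` of an `L²` function with the unimodular multiplier is in `L²`, with the
same norm. [folklore] -/
theorem memLp_archChar_mul (x : mixedSpace K) (f : Lp ℂ 2 μ) :
    MemLp (fun u : (mixedSpace K)ˣ => archChar K (u : mixedSpace K) x * f u) 2 μ := by
  have hg : MemLp (f : (mixedSpace K)ˣ → ℂ) 2 μ := Lp.memLp f
  have h1 : AEStronglyMeasurable (fun u : (mixedSpace K)ˣ => archChar K (u : mixedSpace K) x) μ :=
    (continuous_archChar_coe x).measurable.aestronglyMeasurable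
  have h2 : AEStronglyMeasurable (f : (mixedSpace K)ˣ → ℂ) μ := Lp.aestronglyMeasurable f
  exact hg.of_le (h1.mul h2) (Filter.Eventually.of_forall fun u => by rw [norm_mul, norm_archChar, one_mul])

/-- **Multiplication by the character `u ↦ ψ_∞(u x)`** on `L²(K_∞ˣ, μ)`, a linear isometry. [folklore] -/
def kirillovMulChar (x : mixedSpace K) : Lp ℂ 2 μ →ₗᵢ[ℂ] Lp ℂ 2 μ where
  toFun f := (memLp_archChar_mul μ x f).toLp _
  map_add' f g := by
    refine Lp.ext ?_
    filter_upwards [MemLp.coeFn_toLp (memLp_archChar_mul μ x (f + g)),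
      Lp.coeFn_add ((memLp_archChar_mul μ x f).toLp _) ((memLp_archChar_mul μ x g).toLp _),
      MemLp.coeFn_toLp (memLp_archChar_mul μ x f), MemLp.coeFn_toLp (memLp_archChar_mul μ x g),
      Lp.coeFn_add f g] with u h1 h2 h3 h4 h5
    rw [h1, h2, Pi.add_apply, h3, h4, h5, Pi.add_apply, mul_add]
  map_smul' c f := by
    refine Lp.ext ?_
    filter_upwards [MemLp.coeFn_toLp (memLp_archChar_mul μ x (c • f)),
      Lp.coeFn_smul c ((memLp_archChar_mul μ x f).toLp _),
      MemLp.coeFn_toLp (memLp_archChar_mul μ x f), Lp.coeFn_smul c f] with u h1 h2 h3 h4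
    rw [h1, RingHom.id_apply, h2, Pi.smul_apply, h3, h4, Pi.smul_apply, smul_eq_mul, smul_eq_mul, mul_left_comm]
  norm_map' f := by
    change ‖(memLp_archChar_mul μ x f).toLp _‖ = ‖f‖
    rw [Lp.norm_toLp, Lp.norm_def]
    congr 1
    refine eLpNorm_congr_norm_ae (Filter.Eventually.of_forall fun u => ?_)
    rw [norm_mul, norm_archChar, one_mul]

omit [μ.IsMulLeftInvariant] in
/-- `kirillovMulChar μ x f = ψ_∞(· x) f` almost everywhere. [folklore] -/
theorem coeFn_kirillovMulChar (x : mixedSpace K) (f : Lp ℂ 2 μ) :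
    kirillovMulChar μ x f =ᵐ[μ] fun u => archChar K (u : mixedSpace K) x * f u :=
  MemLp.coeFn_toLp (memLp_archChar_mul μ x f)

omit [MeasurableSpace ((mixedSpace K)ˣ)] [BorelSpace ((mixedSpace K)ˣ)] in
/-- Additivity of the character in the second variable: `ψ_∞(ξ(x + y)) = ψ_∞(ξ x) ψ_∞(ξ y)`. [folklore] -/
theorem archChar_add_right (ξ x y : mixedSpace K) : archChar K ξ (x + y) = archChar K ξ x * archChar K ξ y := by
  unfold archChar
  rw [map_add, Complex.ofReal_add, add_mul, Complex.exp_add]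

omit [MeasurableSpace ((mixedSpace K)ˣ)] [BorelSpace ((mixedSpace K)ˣ)] in
/-- `ψ_∞(ξ · 0) = 1`. [folklore] -/
theorem archChar_zero_right (ξ : mixedSpace K) : archChar K ξ 0 = 1 := by
  unfold archChar
  rw [map_zero, Complex.ofReal_zero, zero_mul, Complex.exp_zero]

omit [MeasurableSpace ((mixedSpace K)ˣ)] [BorelSpace ((mixedSpace K)ˣ)] in
/-- Moving a scalar across the character: `ψ_∞((ξ y) x) = ψ_∞(ξ (y x))`. [folklore] -/
theorem archChar_mul_left (ξ y x : mixedSpace K) : archChar K (ξ * y) x = archChar K ξ (y * x) := by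
  unfold archChar
  rw [mul_comm ξ y, archCharForm_mul_left]

/-! ### 3. The Kirillov representation -/

/-- **The Kirillov representation of `P₂(K_∞)` on `L²(K_∞ˣ)`**:
`(ρ(p) f)(u) = ψ_∞(u p₀₁) f(u p₀₀)`, the induced representation `Ind_{N₂}^{P₂} θ` realised on
`L²(N₂\P₂) ≅ L²(K_∞ˣ)` (Jacquet–Shalika (1981), (3.5); Bump (1997), §2.8). As operators:
`ρ(p) = M_{p₀₁} ∘ D_{p₀₀}`. [cite: JacquetShalikaAJM1981, §3, (3.5)] -/
def kirillovRep : ContRepresentation ℂ (mirabolicTwo K) (Lp ℂ 2 μ) where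
  toMonoidHom :=
  { toFun := fun p =>
      (kirillovMulChar μ (((p : GL (Fin 2) (mixedSpace K)) : Matrix (Fin 2) (Fin 2) (mixedSpace K)) 0 1)).toContinuousLinearMap ∘L
        (kirillovDilation μ (mirabolicFst p)).toContinuousLinearMap
    map_one' := by
      refine ContinuousLinearMap.ext fun f => Lp.ext ?_
      change ((kirillovMulChar μ ((((1 : mirabolicTwo K) : GL (Fin 2) (mixedSpace K)) : Matrix (Fin 2) (Fin 2) (mixedSpace K)) 0 1))
        (kirillovDilation μ (mirabolicFst 1) f) : (mixedSpace K)ˣ → ℂ) =ᵐ[μ] f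
      rw [map_one]
      filter_upwards [coeFn_kirillovMulChar μ ((((1 : mirabolicTwo K) : GL (Fin 2) (mixedSpace K)) : Matrix (Fin 2) (Fin 2) (mixedSpace K)) 0 1)
          (kirillovDilation μ 1 f),
        coeFn_kirillovDilation μ 1 f] with u h1 h2
      rw [h1, h2, mul_one]
      have : ((((1 : mirabolicTwo K) : GL (Fin 2) (mixedSpace K)) : Matrix (Fin 2) (Fin 2) (mixedSpace K)) 0 1) = 0 := by
        simp
      rw [this, archChar_zero_right, one_mul]
    map_mul' := fun p q => by
      refine ContinuousLinearMap.ext fun f => Lp.ext ?_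
      set a := mirabolicFst p with ha
      set b := mirabolicFst q with hb
      set x := ((p : GL (Fin 2) (mixedSpace K)) : Matrix (Fin 2) (Fin 2) (mixedSpace K)) 0 1 with hx
      set y := ((q : GL (Fin 2) (mixedSpace K)) : Matrix (Fin 2) (Fin 2) (mixedSpace K)) 0 1 with hy
      have hxy : (((p * q : mirabolicTwo K) : GL (Fin 2) (mixedSpace K)) : Matrix (Fin 2) (Fin 2) (mixedSpace K)) 0 1 =
          (a : mixedSpace K) * y + x := by
        rw [mirabolicTwo_mul_entry01]; rfl
      change ((kirillovMulChar μ ((((p * q : mirabolicTwo K) : GL (Fin 2) (mixedSpace K)) : Matrix (Fin 2) (Fin 2) (mixedSpace K)) 0 1))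
          (kirillovDilation μ (mirabolicFst (p * q)) f) : (mixedSpace K)ˣ → ℂ) =ᵐ[μ]
        ((kirillovMulChar μ x) (kirillovDilation μ a
          ((kirillovMulChar μ y) (kirillovDilation μ b f))) : (mixedSpace K)ˣ → ℂ)
      rw [map_mul, hxy]
      -- the inner function `g = M_y D_b f` and its translate by `a`
      set g : Lp ℂ 2 μ := (kirillovMulChar μ y) (kirillovDilation μ b f) with hg
      have hg_ae : (g : (mixedSpace K)ˣ → ℂ) =ᵐ[μ] fun u => archChar K (u : mixedSpace K) y * f (u * b) := by
        filter_upwards [coeFn_kirillovMulChar μ y (kirillovDilation μ b f), coeFn_kirillovDilation μ b f] with u h1 h2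
        rw [h1, h2]
      have hg_comp : (fun u => (g : (mixedSpace K)ˣ → ℂ) (u * a)) =ᵐ[μ]
          fun u => archChar K ((u * a : (mixedSpace K)ˣ) : mixedSpace K) y * f (u * a * b) :=
        (measurePreserving_mul_right μ a).quasiMeasurePreserving.ae_eq_comp hg_ae
      filter_upwards [coeFn_kirillovMulChar μ ((a : mixedSpace K) * y + x) (kirillovDilation μ (a * b) f),
        coeFn_kirillovDilation μ (a * b) f,
        coeFn_kirillovMulChar μ x (kirillovDilation μ a g), coeFn_kirillovDilation μ a g, hg_comp] with u h1 h2 h3 h4 h5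
      rw [h1, h2, h3, h4, h5, archChar_add_right, Units.val_mul, ← archChar_mul_left, mul_assoc u a b]
      ring }

/-- Unfolding the Kirillov representation: `ρ(p) = M_{p₀₁} ∘ D_{p₀₀}`. [folklore] -/
theorem kirillovRep_apply (p : mirabolicTwo K) (f : Lp ℂ 2 μ) :
    kirillovRep μ p f = kirillovMulChar μ (((p : GL (Fin 2) (mixedSpace K)) : Matrix (Fin 2) (Fin 2) (mixedSpace K)) 0 1)
      (kirillovDilation μ (mirabolicFst p) f) :=
  rfl

/-- **The Kirillov representation, pointwise**: `(ρ(p) f)(u) = ψ_∞(u p₀₁) f(u p₀₀)` a.e.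
[cite: JacquetShalikaAJM1981, §3, (3.5)] -/
theorem coeFn_kirillovRep (p : mirabolicTwo K) (f : Lp ℂ 2 μ) :
    kirillovRep μ p f =ᵐ[μ] fun u => archChar K (u : mixedSpace K)
      (((p : GL (Fin 2) (mixedSpace K)) : Matrix (Fin 2) (Fin 2) (mixedSpace K)) 0 1) * f (u * mirabolicFst p) := by
  rw [kirillovRep_apply]
  filter_upwards [coeFn_kirillovMulChar μ (((p : GL (Fin 2) (mixedSpace K)) : Matrix (Fin 2) (Fin 2) (mixedSpace K)) 0 1)
      (kirillovDilation μ (mirabolicFst p) f), coeFn_kirillovDilation μ (mirabolicFst p) f] with u h1 h2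
  rw [h1, h2]

/-- `ρ(p)` is an isometry. [folklore] -/
theorem norm_kirillovRep_apply (p : mirabolicTwo K) (f : Lp ℂ 2 μ) : ‖kirillovRep μ p f‖ = ‖f‖ := by
  rw [kirillovRep_apply, LinearIsometry.norm_map, LinearIsometry.norm_map]

/-- **The Kirillov representation is unitary** (`ρ(p)` is a surjective isometry, with inverse
`ρ(p⁻¹)`). [cite: JacquetShalikaAJM1981, §3, (3.5)] -/
theorem isUnitary_kirillovRep : (kirillovRep μ : ContRepresentation ℂ (mirabolicTwo K) (Lp ℂ 2 μ)).IsUnitary := by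
  intro p
  have hu : IsUnit (kirillovRep μ p) := (Group.isUnit p).map (kirillovRep μ).toMonoidHom
  exact hu.mem_unitary_of_star_mul_self
    ((kirillovRep μ p).norm_map_iff_adjoint_comp_self.mp (norm_kirillovRep_apply μ p))

end Operators

end Literature.NumberTheory.Automorphic
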